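import Literature.MathematicalPhysics.QuantumFieldTheory.WilsonFinTorusTwistedPartitionDomination
import Literature.MathematicalPhysics.QuantumFieldTheory.WilsonFinTorusMagneticFluxEnergies
import HarnessLib

/-!
# 't Hooft's MAGNETIC flux energy of a finite box: the zero-temperature limit of `F(0, m; a, β) − F(0, 0; a, β)` exists
# on every box and is `≥ 0`

Topic `Literature/MathematicalPhysics/QuantumFieldTheory`; sequel of `WilsonFinTorusMagneticFluxSectors.lean` (the electric
sectors `Z_{ψ,m}` at a fixed magnetic twist tensor; 't Hooft's `e^{−βF(e,m;a,β)} = wilsonFinTorusFluxTransform …`),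
`WilsonFinTorusTwistedPartitionDomination.lean` (`W{z} ≤ Z` for all six central twists by the transfer matrix),
`WilsonFinTorusMagneticFluxEnergies.lean` (the electric flux energies `E_{ψ|m}` above the ground state of a magnetic sector) and
the kernel-level `Literature/Analysis/OperatorTheory/TwistedKernelFluxEnergies.lean` (sector tops, 't Hooft's limit).

AS PRINTED.  G. 't Hooft, Nucl. Phys. B 153 (1979) 141, §5 after (5.4): «In the limit β → ∞ (or T → 0), F becomes the energy of
the lowest state with the given flux configuration»; §8 (8.10): «Now we can take the limit β → ∞ to obtain the energy of a
magnetic flux» (reprint C. Rebbi (ed.) 1983, pp. 553, 557).  On the lattice, with the temporal period `M + 2` as inverse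
temperature and `e = 0`:

* `wilsonFinTorusMagneticGroundEnergy ρ β φ m₁₂ m₀₂ m₀₁ a b c := lim_M (1/M)·log (Re e^{−F}(0|0)(a,b,c,M+2) / Re e^{−F}(0|m)(a,b,c,M+2))`
  — THE ENERGY OF THE MAGNETIC FLUX `m` of the box `a × b × c` above the untwisted vacuum, `E(0, m; a) − E(0, 0; a)`
  (a DEFINITION via `limUnder`).

PROVED (`β ≥ 0`, continuous unitary `ρ` of a compact metrisable `G`, hom-like centre-valued `φ : Γ → Z(G)`):

* ★ `tendsto_wilsonFinTorusMagneticGroundEnergy` — **the limit exists on EVERY box, unconditionally** (`= log λ₀(0) − log λ₀(m)`,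
  the ground-state levels of the untwisted and of the `m`-twisted transfer operators; the `e = 0` sectors are populated by the
  respective ground states);
* `wilsonFinTorusMagneticGroundEnergy_zero` — `= 0` at `m = 0`;
* ★ `wilsonFinTorusMagneticGroundEnergy_nonneg` — **`E(0, m; a) − E(0, 0; a) ≥ 0`** for every magnetic flux on every box with
  `a, c ≥ 2`: `λ₀(m)^{M+2} ≤ Re e^{−F}(0|m)(M+2) ≤ Z(M+2) ≤ λ₀(0)^M Z(2)` for all `M` (ground-state lower bound, domination
  `wilsonFinTorusTensorTwistedPartition_le_partition`, trace formula), hence `λ₀(m) ≤ λ₀(0)`;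
* `exists_groundLevels_wilsonFinTorusFluxTransform` — the finite-`M` form of the same chain: levels `0 < λ₀(m) ≤ λ₀(0)`
  with `λ₀(m)^M λ₀(m)² ≤ Re e^{−F}(0|m)(M+2) ≤ Z(M+2) ≤ λ₀(0)^M Z(2)` for every `M`.
* ★ `tendsto_log_wilsonFinTorusFluxTransform_vacuum_div_of_flux` — for the fluxes seen by `ρ` (scalar `ρ∘φ = χ·1`, room
  `n₀ ≤ bc, n₁ ≤ ac, n₂ ≤ ab`, `β > 0`): `(1/M)·log (Re e^{−F}(0|0)(M+2) / Re e^{−F}(e|m)(M+2)) → E_{e|m} + E_m` — the energy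
  of the `(e, m)` sector above the untwisted vacuum exists and SPLITS into the electric energy in the magnetic sector
  (`wilsonFinTorusFluxTransformEnergy`, the sequel file `WilsonFinTorusMagneticFluxEnergies.lean`) plus the magnetic energy;
  `…_add_magneticGroundEnergy_nonneg` (`≥ 0`, `a, c ≥ 2`) and `…_pos` (`> 0` for `e ≠ 0`).

HONEST FRAMING: a finite-volume LEVEL difference at fixed `β`; `≥ 0` is the weakest statement (it is the SIGN of the magnetic
flux free energy, not a rate); nothing about its behaviour as `a_i → ∞` — 't Hooft's heavy∕light alternative (§7), the
`e^{−ρ a₁a₂}` law (8.11) of the confinement phase — duality consequences, an area law or a mass gap.  The Yang–Mills mass gap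
(Clay) is NOT proved by any of this; R4 closes only the conditional finite-𝕋⁴ rung `BalabanLadder.UV`.  No `instance`, no
`sorry`; standard axioms.

References: 't Hooft 1979 §5, §8; T. Kanazawa, Ann. Phys. 324 (2009) 141 [Kanazawa2008], §2 Lemma 2; M. Lüscher, Commun. Math. Phys. 54 (1977)
283; M. Reed, B. Simon I (1980) Thm VI.16, IV (1978) Thm XIII.43–44.
-/

noncomputable section

open MeasureTheory Filter Function Finset Topology
open scoped ENNReal ComplexConjugate BigOperators
open Literature.Analysis.OperatorTheory

namespace Literature.MathematicalPhysics.QuantumFieldTheory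

variable {G : Type*} [Group G] [TopologicalSpace G] [IsTopologicalGroup G] [CompactSpace G]
  [MeasurableSpace G] [BorelSpace G] {N : ℕ} (ρ : G →* Matrix (Fin N) (Fin N) ℂ)
  {Γ : Type*} [AddCommGroup Γ] [Fintype Γ]

/-! ### §1 The magnetic flux energy of a finite box -/

/-- **'t Hooft's magnetic flux energy of a finite box** (`e = 0`, measured from the untwisted vacuum):
`E_m(a,b,c; β) := lim_{M → ∞} (1/M) · log (Re e^{−F}(0 | 0)(a,b,c,M+2) / Re e^{−F}(0 | m)(a,b,c,M+2))`, `m = (m₁₂, m₀₂, m₀₁)` —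
«the limit β → ∞ to obtain the energy of a magnetic flux».  Defined through `limUnder`; the limit is proved to exist on every
box (`tendsto_wilsonFinTorusMagneticGroundEnergy`). [cite: tHooft1979Flux, §5 after (5.4) and §8 (8.10)]
[cite: Greensite2011, §4.4 (4.41)–(4.44)] -/
def wilsonFinTorusMagneticGroundEnergy (β : ℝ) (φ : Γ → G) (m₁₂ m₀₂ m₀₁ : Γ) (a b c : ℕ) : ℝ :=
  limUnder atTop fun M : ℕ =>
    Real.log ((wilsonFinTorusFluxTransform ρ β φ 0 0 0 0 0 0 a b c (M + 2)).re /
        (wilsonFinTorusFluxTransform ρ β φ 0 0 0 m₁₂ m₀₂ m₀₁ a b c (M + 2)).re) / M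

/-- Unfolding lemma. [cite: tHooft1979Flux, §5 after (5.4)] -/
theorem wilsonFinTorusMagneticGroundEnergy_def (β : ℝ) (φ : Γ → G) (m₁₂ m₀₂ m₀₁ : Γ) (a b c : ℕ) :
    wilsonFinTorusMagneticGroundEnergy ρ β φ m₁₂ m₀₂ m₀₁ a b c = limUnder atTop (fun M : ℕ =>
      Real.log ((wilsonFinTorusFluxTransform ρ β φ 0 0 0 0 0 0 a b c (M + 2)).re /
        (wilsonFinTorusFluxTransform ρ β φ 0 0 0 m₁₂ m₀₂ m₀₁ a b c (M + 2)).re) / M) := rfl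

/-- **No magnetic flux costs nothing**: `E_{m = 0} = 0` (no hypotheses). [cite: tHooft1979Flux, §8 after (8.7)] -/
theorem wilsonFinTorusMagneticGroundEnergy_zero (β : ℝ) (φ : Γ → G) (a b c : ℕ) :
    wilsonFinTorusMagneticGroundEnergy ρ β φ 0 0 0 a b c = 0 := by
  rw [wilsonFinTorusMagneticGroundEnergy_def]
  have h : (fun M : ℕ => Real.log ((wilsonFinTorusFluxTransform ρ β φ 0 0 0 0 0 0 a b c (M + 2)).re /
      (wilsonFinTorusFluxTransform ρ β φ 0 0 0 0 0 0 a b c (M + 2)).re) / (M : ℝ)) = fun _ => 0 := by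
    funext M
    rcases eq_or_ne ((wilsonFinTorusFluxTransform ρ β φ 0 0 0 0 0 0 a b c (M + 2)).re) 0 with h0 | h0
    · simp [h0]
    · simp [div_self h0]
  rw [h]
  exact tendsto_const_nhds.limUnder_eq

section Spectral

variable [SecondCountableTopology G]

/-- Growth comparison (plumbing): if `x^(M+2) ≤ C · y^M` for all `M` with `x > 0`, `y ≥ 0`, then `x ≤ y`. [folklore] -/
private theorem mgg_le_of_pow_succ_succ_le {x y C : ℝ} (hx : 0 < x) (hy : 0 ≤ y) (h : ∀ M : ℕ, x ^ (M + 2) ≤ C * y ^ M) :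
    x ≤ y := by
  by_contra hlt
  push Not at hlt
  rcases hy.eq_or_lt with hy0 | hy0
  · -- `y = 0`: `x³ ≤ C · 0`
    have h1 := h 1
    rw [← hy0, pow_one, mul_zero] at h1
    exact absurd h1 (not_le.2 (pow_pos hx 3))
  · have hr : 1 < x / y := (one_lt_div hy0).2 hlt
    have hev := (tendsto_pow_atTop_atTop_of_one_lt hr).eventually_gt_atTop (C / x ^ 2)
    obtain ⟨M, hM⟩ := hev.exists
    have hyM : 0 < y ^ M := pow_pos hy0 M
    have h2 : (x / y) ^ M * x ^ 2 ≤ C := by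
      rw [div_pow, div_mul_eq_mul_div, div_le_iff₀ hyM]
      calc x ^ M * x ^ 2 = x ^ (M + 2) := by ring
        _ ≤ C * y ^ M := h M
    have h3 : C / x ^ 2 < (x / y) ^ M := hM
    rw [div_lt_iff₀ (pow_pos hx 2)] at h3
    linarith

/-- MASTER LEMMA (plumbing): for the `Γ`-family flux sectors at a magnetic twist tensor `zM`, the ground-state level
`λ₀(m) = ‖𝕋_m‖ > 0` with (i) `(1/M) log Re Z_{0,m}(M+2) → log λ₀(m)`, (ii) `λ₀(m)^M λ₀(m)² ≤ Re Z_{0,m}(M+2)`, and (iii) the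
trace-formula bound `W{0,m}(M+2) ≤ λ₀(m)^M · W{0,m}(2)` — all from ONE eigenbasis of the twisted transfer operator. [folklore] -/
private theorem mgg_ground_spectral (hρ : Continuous ρ) (hρu : ∀ g, ρ g ∈ Matrix.unitaryGroup (Fin N) ℂ)
    {β : ℝ} (hβ : 0 ≤ β) (zM : Fin 4 → Fin 4 → G) {φ : Γ → Fin 4 → G} (hφ0 : φ 0 = 1)
    (hφadd : ∀ k k', φ (k + k') = φ k * φ k') (hφc : ∀ k (i : Fin 3), φ k i.castSucc ∈ Subgroup.center G)
    (b₁ b₂ b₃ : ℕ) :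
    ∃ lam₀ : ℝ, 0 < lam₀ ∧
      Tendsto (fun M : ℕ => Real.log (wilsonFinTorusMagneticFluxPartition ρ β zM φ 0 b₁ b₂ b₃ (M + 2)).re / M) atTop
        (𝓝 (Real.log lam₀)) ∧
      (∀ M : ℕ, lam₀ ^ M * lam₀ ^ 2 ≤ (wilsonFinTorusMagneticFluxPartition ρ β zM φ 0 b₁ b₂ b₃ (M + 2)).re) ∧
      (∀ M : ℕ, wilsonFinTorusTensorTwistedPartition ρ β (elecMagTwistTensor (1 : Fin 4 → G) zM) b₁ b₂ b₃ (M + 2) ≤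
        lam₀ ^ M * wilsonFinTorusTensorTwistedPartition ρ β (elecMagTwistTensor (1 : Fin 4 → G) zM) b₁ b₂ b₃ 2) := by
  haveI : IsFiniteMeasure (haarProbability G) := by
    dsimp [haarProbability]; infer_instance
  obtain ⟨C, A, s, hcnt, b, lam, i₀, hC, hA, hb, hlam, hi₀, hL0⟩ :=
    exists_eigenbasis_finTorusSliceKernelTw hρ hρu hβ (finSliceTwistTensor zM : FinSpatialSite b₁ b₂ b₃ → Fin 3 → Fin 3 → G)
  haveI : Countable s := hcnt
  have hK := stronglyMeasurable_uncurry_finTorusSliceKernelTw (b₁ := b₁) (b₂ := b₂) (b₃ := b₃) ρ hρ β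
    (finSliceTwistTensor zM)
  have hsymm : ∀ x y : FinSpatialSite b₁ b₂ b₃ × Fin 3 → G,
      finTorusSliceKernelTw ρ β (finSliceTwistTensor zM) x y = finTorusSliceKernelTw ρ β (finSliceTwistTensor zM) y x :=
    finTorusSliceKernelTw_symm ρ hρu β _
  have hKpos : ∀ x y : FinSpatialSite b₁ b₂ b₃ × Fin 3 → G, 0 < finTorusSliceKernelTw ρ β (finSliceTwistTensor zM) x y :=
    finTorusSliceKernelTw_pos ρ hρ β _
  have hT0 : (finSliceTwist (φ 0) : (FinSpatialSite b₁ b₂ b₃ × Fin 3 → G) → _) = id := by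
    rw [hφ0]; exact finSliceTwist_one
  have hTadd : ∀ (k k' : Γ) (x : FinSpatialSite b₁ b₂ b₃ × Fin 3 → G),
      finSliceTwist (φ (k + k')) x = finSliceTwist (φ k) (finSliceTwist (φ k') x) := fun k k' x => by
    rw [finSliceTwist_finSliceTwist, hφadd]
  have hT : ∀ k : Γ, MeasurePreserving (finSliceTwist (φ k) : (FinSpatialSite b₁ b₂ b₃ × Fin 3 → G) → _)
      (Measure.pi fun _ => haarProbability G) (Measure.pi fun _ => haarProbability G) :=
    fun k => measurePreserving_finSliceTwist (φ k)
  have hKT : ∀ (k : Γ) (x y : FinSpatialSite b₁ b₂ b₃ × Fin 3 → G),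
      finTorusSliceKernelTw ρ β (finSliceTwistTensor zM) (finSliceTwist (φ k) x) (finSliceTwist (φ k) y) =
        finTorusSliceKernelTw ρ β (finSliceTwistTensor zM) x y :=
    fun k x y => finTorusSliceKernelTw_finSliceTwist ρ (hφc k) β _ x y
  have hz : ∀ (k : Γ) (M : ℕ),
      (fun k n => wilsonFinTorusTensorTwistedPartition ρ β (elecMagTwistTensor (φ k) zM) b₁ b₂ b₃ n) k (M + 2) =
      ∫ x, ((fun f : (FinSpatialSite b₁ b₂ b₃ × Fin 3 → G) → ℝ => fun u =>
            ∫ y, finTorusSliceKernelTw ρ β (finSliceTwistTensor zM) u y * f y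
              ∂(Measure.pi fun _ : FinSpatialSite b₁ b₂ b₃ × Fin 3 => haarProbability G))^[M + 1]
          (fun y => finTorusSliceKernelTw ρ β (finSliceTwistTensor zM) y x)) (finSliceTwist (φ k) x)
        ∂(Measure.pi fun _ : FinSpatialSite b₁ b₂ b₃ × Fin 3 => haarProbability G) :=
    fun k M => wilsonFinTorusTensorTwistedPartition_elecMag_eq_integral_iterate ρ hρ β (hφc k) zM b₁ b₂ b₃ M
  have hlam0 : ∀ i, 0 ≤ lam i := fun i => (hlam i).1
  -- the flux-free sector is non-degenerate (it carries the ground state)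
  have hne0 := exists_fluxCoeff_zero_ne_zero (T := fun k => finSliceTwist (φ k)) hK hC hsymm hKpos hA hb hT hKT hi₀ hL0
  have hL0' : 0 < lam i₀ := lt_of_le_of_ne (hlam0 i₀) (Ne.symm hL0)
  -- (i): the rate of the flux-free sector is its top, which is the ground-state level `λ₀`
  have hlim := tendsto_log_re_fluxSector_div hK hC hsymm hA hb hlam0 hT hT0 hTadd hz hne0
  rw [fluxTop_zero_eq hK hC hsymm hKpos hA hb hT hKT hi₀ hL0] at hlim
  -- (iii): trace formula `W{0,m}(M+2) = Σᵢ λᵢ^{M+2} ≤ λ₀^M Σᵢ λᵢ²`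
  have hz1 : ∀ i : Fin 3, elecMagTwistTensor (1 : Fin 4 → G) zM i.castSucc 3 = 1 := fun i => by
    rw [elecMagTwistTensor_three, Pi.one_apply]
  have hZ : ∀ M : ℕ, HasSum (fun i => lam i ^ (M + 2))
      (wilsonFinTorusTensorTwistedPartition ρ β (elecMagTwistTensor (1 : Fin 4 → G) zM) b₁ b₂ b₃ (M + 2)) := fun M => by
    rw [wilsonFinTorusTensorTwistedPartition_eq_integral_prod_finTorusSliceKernelTw_of_eq_one ρ hρ β hz1 b₁ b₂ b₃ (M + 2),
      finSliceTwistTensor_elecMagTwistTensor]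
    simp_rw [finRotate_apply]
    exact hasSum_pow_integral_cyclic hK hC hsymm hA hb hlam0 M
  refine ⟨lam i₀, hL0', hlim, fun M => ?_, fun M => ?_⟩
  · exact le_re_fluxSector_zero (T := fun k => finSliceTwist (φ k)) hK hC hsymm hKpos hA hb hlam0 hi₀ hL0 hT hT0
      hTadd hKT hz M
  · have h2 := hZ 0
    simp only [Nat.zero_add] at h2
    refine hasSum_le (fun i => ?_) (hZ M) (h2.mul_left (lam i₀ ^ M))
    calc lam i ^ (M + 2) = lam i ^ M * lam i ^ 2 := by ring
      _ ≤ lam i₀ ^ M * lam i ^ 2 :=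
          mul_le_mul_of_nonneg_right (pow_le_pow_left₀ (hlam0 i) (hlam i).2 M) (sq_nonneg _)

omit [TopologicalSpace G] [IsTopologicalGroup G] [CompactSpace G] [MeasurableSpace G] [BorelSpace G]
  [SecondCountableTopology G] [Fintype Γ] in
/-- The three-slot twist family `k ↦ ![φ k₀, φ k₁, φ k₂, 1]` of a hom-like centre-valued `φ` is a central hom-like family
(plumbing). [cite: tHooft1979Flux, §4 (4.2) and (4.4)] -/
private theorem mgg_tripleTwist_hom {φ : Γ → G} (hφ0 : φ 0 = 1) (hφadd : ∀ k k', φ (k + k') = φ k * φ k')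
    (hφc : ∀ k, φ k ∈ Subgroup.center G) :
    (fun k : Γ × Γ × Γ => (![φ k.1, φ k.2.1, φ k.2.2, 1] : Fin 4 → G)) 0 = 1 ∧
      (∀ k k' : Γ × Γ × Γ, (![φ (k + k').1, φ (k + k').2.1, φ (k + k').2.2, 1] : Fin 4 → G) =
        ![φ k.1, φ k.2.1, φ k.2.2, 1] * ![φ k'.1, φ k'.2.1, φ k'.2.2, 1]) ∧
      ∀ (k : Γ × Γ × Γ) (i : Fin 3), (![φ k.1, φ k.2.1, φ k.2.2, 1] : Fin 4 → G) i.castSucc ∈ Subgroup.center G := by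
  refine ⟨?_, fun k k' => ?_, fun k i => ?_⟩
  · funext μ
    fin_cases μ <;> simp [hφ0]
  · funext μ
    fin_cases μ <;> simp [hφadd]
  · fin_cases i
    · exact hφc _
    · exact hφc _
    · exact hφc _

/-- ★ **The magnetic flux energy of a finite box exists, unconditionally**: for `β ≥ 0`, continuous unitary `ρ`, hom-like
centre-valued `φ`, every `m = (m₁₂, m₀₂, m₀₁)` and EVERY box `a × b × c`,
`(1/M) · log (Re e^{−F}(0|0)(M+2) / Re e^{−F}(0|m)(M+2)) → E_m = wilsonFinTorusMagneticGroundEnergy …` (`= log λ₀(0) − log λ₀(m)`,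
the ground-state levels of the untwisted and of the `m`-twisted transfer operators of the box).
[cite: tHooft1979Flux, §5 after (5.4) and §8 (8.10)] [cite: ReedSimonIV1978, Thm XIII.43 and Thm XIII.44] -/
theorem tendsto_wilsonFinTorusMagneticGroundEnergy (hρ : Continuous ρ) (hρu : ∀ g, ρ g ∈ Matrix.unitaryGroup (Fin N) ℂ)
    {β : ℝ} (hβ : 0 ≤ β) {φ : Γ → G} (hφ0 : φ 0 = 1) (hφadd : ∀ k k', φ (k + k') = φ k * φ k')
    (hφc : ∀ k, φ k ∈ Subgroup.center G) (m₁₂ m₀₂ m₀₁ : Γ) (a b c : ℕ) :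
    Tendsto (fun M : ℕ => Real.log ((wilsonFinTorusFluxTransform ρ β φ 0 0 0 0 0 0 a b c (M + 2)).re /
        (wilsonFinTorusFluxTransform ρ β φ 0 0 0 m₁₂ m₀₂ m₀₁ a b c (M + 2)).re) / M) atTop
      (𝓝 (wilsonFinTorusMagneticGroundEnergy ρ β φ m₁₂ m₀₂ m₀₁ a b c)) := by
  obtain ⟨h0, hadd, hc⟩ := mgg_tripleTwist_hom (Γ := Γ) hφ0 hφadd hφc
  have htriv : tripleFluxChar (0 : AddChar Γ ℂ) 0 0 = 0 := (tripleFluxChar_eq_zero_iff 0 0 0).2 ⟨rfl, rfl, rfl⟩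
  obtain ⟨l₀, hl₀, hlim₀, hvac₀, -⟩ := mgg_ground_spectral ρ hρ hρu hβ
    (fun μ ν => φ (twistIdx (0 : Γ) 0 0 0 0 0 μ ν)) h0 hadd hc a b c
  obtain ⟨lₘ, hlₘ, hlimₘ, hvacₘ, -⟩ := mgg_ground_spectral ρ hρ hρu hβ
    (fun μ ν => φ (twistIdx (0 : Γ) 0 0 m₁₂ m₀₂ m₀₁ μ ν)) h0 hadd hc a b c
  have hlim : Tendsto (fun M : ℕ => Real.log ((wilsonFinTorusFluxTransform ρ β φ 0 0 0 0 0 0 a b c (M + 2)).re /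
      (wilsonFinTorusFluxTransform ρ β φ 0 0 0 m₁₂ m₀₂ m₀₁ a b c (M + 2)).re) / M) atTop
      (𝓝 (Real.log l₀ - Real.log lₘ)) := by
    have h := hlim₀.sub hlimₘ
    refine h.congr' ?_
    filter_upwards with M
    simp only [wilsonFinTorusFluxTransform_eq_magneticFluxPartition ρ β hφ0, htriv]
    rw [← sub_div, ← Real.log_div]
    · exact (lt_of_lt_of_le (by positivity) (hvac₀ M)).ne'
    · exact (lt_of_lt_of_le (by positivity) (hvacₘ M)).ne'
  rw [wilsonFinTorusMagneticGroundEnergy_def, hlim.limUnder_eq]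
  exact hlim

/-- ★ **The magnetic flux energy of a finite box is non-negative: `E(0, m; a) − E(0, 0; a) ≥ 0`** for every magnetic flux
`m`, every box with `a, c ≥ 2`, `β ≥ 0`, continuous unitary `ρ`, hom-like centre-valued `φ`.  Mechanism:
`λ₀(m)^{M+2} ≤ Re e^{−F}(0|m)(M+2) ≤ Z(a,b,c,M+2) ≤ λ₀(0)^M · Z(a,b,c,2)` for every `M` — the ground state of the magnetic sector,
the domination `W{0,m} ≤ Z` (`wilsonFinTorusTensorTwistedPartition_le_partition`, by the transfer matrix) and the trace formula —
so `λ₀(m) ≤ λ₀(0)`: a magnetic twist never raises the top of the transfer-operator spectrum.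
[cite: tHooft1979Flux, §5 (5.4) and §8 (8.10)] [cite: Kanazawa2008, §2 Lemma 2 eq. (17)–(18)]
[cite: ReedSimonIV1978, Thm XIII.43 and Thm XIII.44] -/
theorem wilsonFinTorusMagneticGroundEnergy_nonneg (hρ : Continuous ρ) (hρu : ∀ g, ρ g ∈ Matrix.unitaryGroup (Fin N) ℂ)
    {β : ℝ} (hβ : 0 ≤ β) {φ : Γ → G} (hφ0 : φ 0 = 1) (hφadd : ∀ k k', φ (k + k') = φ k * φ k')
    (hφc : ∀ k, φ k ∈ Subgroup.center G) (m₁₂ m₀₂ m₀₁ : Γ) {a b c : ℕ} (ha : 2 ≤ a) (hc2 : 2 ≤ c) :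
    0 ≤ wilsonFinTorusMagneticGroundEnergy ρ β φ m₁₂ m₀₂ m₀₁ a b c := by
  obtain ⟨h0, hadd, hc⟩ := mgg_tripleTwist_hom (Γ := Γ) hφ0 hφadd hφc
  have htriv : tripleFluxChar (0 : AddChar Γ ℂ) 0 0 = 0 := (tripleFluxChar_eq_zero_iff 0 0 0).2 ⟨rfl, rfl, rfl⟩
  obtain ⟨l₀, hl₀, hlim₀, hvac₀, htr₀⟩ := mgg_ground_spectral ρ hρ hρu hβ
    (fun μ ν => φ (twistIdx (0 : Γ) 0 0 0 0 0 μ ν)) h0 hadd hc a b c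
  obtain ⟨lₘ, hlₘ, hlimₘ, hvacₘ, -⟩ := mgg_ground_spectral ρ hρ hρu hβ
    (fun μ ν => φ (twistIdx (0 : Γ) 0 0 m₁₂ m₀₂ m₀₁ μ ν)) h0 hadd hc a b c
  -- the untwisted tensor: `W{elecMag 1 (φ∘twistIdx 0)} = Z`
  have hZ : ∀ n : ℕ, wilsonFinTorusTensorTwistedPartition ρ β
      (elecMagTwistTensor (1 : Fin 4 → G) (fun μ ν => φ (twistIdx (0 : Γ) 0 0 0 0 0 μ ν))) a b c n =
      wilsonFinTorusPartition ρ β a b c n := fun n =>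
    wilsonFinTorusTensorTwistedPartition_eq_partition_of_forall_eq_one ρ β (fun μ ν hμν => by
      fin_cases μ <;> fin_cases ν <;> simp (config := { decide := true }) [twistIdx, elecMagTwistTensor, hφ0] at hμν ⊢) _ _ _ _
  -- `λ₀(m)^{M+2} ≤ Re Z_{0,m}(M+2) ≤ Z(M+2) ≤ λ₀(0)^M Z(2)`
  have hchain : ∀ M : ℕ, lₘ ^ (M + 2) ≤ wilsonFinTorusPartition ρ β a b c 2 * l₀ ^ M := fun M => by
    have h1 : lₘ ^ M * lₘ ^ 2 ≤ (wilsonFinTorusMagneticFluxPartition ρ β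
        (fun μ ν => φ (twistIdx (0 : Γ) 0 0 m₁₂ m₀₂ m₀₁ μ ν)) (fun k : Γ × Γ × Γ => ![φ k.1, φ k.2.1, φ k.2.2, 1]) 0
        a b c (M + 2)).re := hvacₘ M
    have h2 : (wilsonFinTorusMagneticFluxPartition ρ β (fun μ ν => φ (twistIdx (0 : Γ) 0 0 m₁₂ m₀₂ m₀₁ μ ν))
        (fun k : Γ × Γ × Γ => ![φ k.1, φ k.2.1, φ k.2.2, 1]) 0 a b c (M + 2)).re ≤
        wilsonFinTorusPartition ρ β a b c (M + 2) := by
      have h := re_wilsonFinTorusFluxTransform_le_partition ρ hρ hρu hβ hφ0 hφadd hφc 0 0 0 m₁₂ m₀₂ m₀₁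
        (b := b) ha hc2 M
      rwa [wilsonFinTorusFluxTransform_eq_magneticFluxPartition ρ β hφ0, htriv] at h
    have h3 : wilsonFinTorusPartition ρ β a b c (M + 2) ≤ l₀ ^ M * wilsonFinTorusPartition ρ β a b c 2 := by
      have h := htr₀ M
      rwa [hZ, hZ] at h
    calc lₘ ^ (M + 2) = lₘ ^ M * lₘ ^ 2 := by ring
      _ ≤ wilsonFinTorusPartition ρ β a b c 2 * l₀ ^ M := by linarith
  have hle : lₘ ≤ l₀ := mgg_le_of_pow_succ_succ_le hlₘ hl₀.le hchain
  -- the energy is `log λ₀(0) − log λ₀(m) ≥ 0`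
  have hlim : Tendsto (fun M : ℕ => Real.log ((wilsonFinTorusFluxTransform ρ β φ 0 0 0 0 0 0 a b c (M + 2)).re /
      (wilsonFinTorusFluxTransform ρ β φ 0 0 0 m₁₂ m₀₂ m₀₁ a b c (M + 2)).re) / M) atTop
      (𝓝 (Real.log l₀ - Real.log lₘ)) := by
    have h := hlim₀.sub hlimₘ
    refine h.congr' ?_
    filter_upwards with M
    simp only [wilsonFinTorusFluxTransform_eq_magneticFluxPartition ρ β hφ0, htriv]
    rw [← sub_div, ← Real.log_div]
    · exact (lt_of_lt_of_le (by positivity) (hvac₀ M)).ne'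
    · exact (lt_of_lt_of_le (by positivity) (hvacₘ M)).ne'
  rw [wilsonFinTorusMagneticGroundEnergy_def, hlim.limUnder_eq]
  exact sub_nonneg.2 (Real.log_le_log hlₘ hle)

/-- **The ground-state level of a magnetic sector never exceeds the vacuum level, in partition-function form**: for every `M`,
`Re e^{−F}(0 | m; a,b,c,M+2) ≤ Z(a,b,c,M+2)` and there are `λ₀(0) ≥ λ₀(m) > 0` with `λ₀(m)^{M+2} ≤ Re e^{−F}(0|m)(M+2)` and
`Z(a,b,c,M+2) ≤ λ₀(0)^M Z(a,b,c,2)` (`a, c ≥ 2`). [cite: tHooft1979Flux, §5 (5.4)] [cite: Kanazawa2008, §2 Lemma 2 eq. (17)–(18)] -/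
theorem exists_groundLevels_wilsonFinTorusFluxTransform (hρ : Continuous ρ)
    (hρu : ∀ g, ρ g ∈ Matrix.unitaryGroup (Fin N) ℂ) {β : ℝ} (hβ : 0 ≤ β) {φ : Γ → G} (hφ0 : φ 0 = 1)
    (hφadd : ∀ k k', φ (k + k') = φ k * φ k') (hφc : ∀ k, φ k ∈ Subgroup.center G) (m₁₂ m₀₂ m₀₁ : Γ) {a b c : ℕ}
    (ha : 2 ≤ a) (hc2 : 2 ≤ c) :
    ∃ lam₀ lamₘ : ℝ, 0 < lamₘ ∧ lamₘ ≤ lam₀ ∧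
      (∀ M : ℕ, lamₘ ^ M * lamₘ ^ 2 ≤ (wilsonFinTorusFluxTransform ρ β φ 0 0 0 m₁₂ m₀₂ m₀₁ a b c (M + 2)).re) ∧
      (∀ M : ℕ, (wilsonFinTorusFluxTransform ρ β φ 0 0 0 m₁₂ m₀₂ m₀₁ a b c (M + 2)).re ≤
        wilsonFinTorusPartition ρ β a b c (M + 2)) ∧
      ∀ M : ℕ, wilsonFinTorusPartition ρ β a b c (M + 2) ≤ lam₀ ^ M * wilsonFinTorusPartition ρ β a b c 2 := by
  obtain ⟨h0, hadd, hc⟩ := mgg_tripleTwist_hom (Γ := Γ) hφ0 hφadd hφc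
  have htriv : tripleFluxChar (0 : AddChar Γ ℂ) 0 0 = 0 := (tripleFluxChar_eq_zero_iff 0 0 0).2 ⟨rfl, rfl, rfl⟩
  obtain ⟨l₀, hl₀, -, -, htr₀⟩ := mgg_ground_spectral ρ hρ hρu hβ
    (fun μ ν => φ (twistIdx (0 : Γ) 0 0 0 0 0 μ ν)) h0 hadd hc a b c
  obtain ⟨lₘ, hlₘ, -, hvacₘ, -⟩ := mgg_ground_spectral ρ hρ hρu hβ
    (fun μ ν => φ (twistIdx (0 : Γ) 0 0 m₁₂ m₀₂ m₀₁ μ ν)) h0 hadd hc a b c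
  have hZ : ∀ n : ℕ, wilsonFinTorusTensorTwistedPartition ρ β
      (elecMagTwistTensor (1 : Fin 4 → G) (fun μ ν => φ (twistIdx (0 : Γ) 0 0 0 0 0 μ ν))) a b c n =
      wilsonFinTorusPartition ρ β a b c n := fun n =>
    wilsonFinTorusTensorTwistedPartition_eq_partition_of_forall_eq_one ρ β (fun μ ν hμν => by
      fin_cases μ <;> fin_cases ν <;> simp (config := { decide := true }) [twistIdx, elecMagTwistTensor, hφ0] at hμν ⊢) _ _ _ _
  have hvac : ∀ M : ℕ, lₘ ^ M * lₘ ^ 2 ≤ (wilsonFinTorusFluxTransform ρ β φ 0 0 0 m₁₂ m₀₂ m₀₁ a b c (M + 2)).re :=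
    fun M => by
    rw [wilsonFinTorusFluxTransform_eq_magneticFluxPartition ρ β hφ0, htriv]
    exact hvacₘ M
  have hdom : ∀ M : ℕ, (wilsonFinTorusFluxTransform ρ β φ 0 0 0 m₁₂ m₀₂ m₀₁ a b c (M + 2)).re ≤
      wilsonFinTorusPartition ρ β a b c (M + 2) := fun M =>
    re_wilsonFinTorusFluxTransform_le_partition ρ hρ hρu hβ hφ0 hφadd hφc 0 0 0 m₁₂ m₀₂ m₀₁ (b := b) ha hc2 M
  have htr : ∀ M : ℕ, wilsonFinTorusPartition ρ β a b c (M + 2) ≤ l₀ ^ M * wilsonFinTorusPartition ρ β a b c 2 := fun M => by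
    have h := htr₀ M
    rwa [hZ, hZ] at h
  have hchain : ∀ M : ℕ, lₘ ^ (M + 2) ≤ wilsonFinTorusPartition ρ β a b c 2 * l₀ ^ M := fun M => by
    have h1 := hvac M
    have h2 := hdom M
    have h3 := htr M
    calc lₘ ^ (M + 2) = lₘ ^ M * lₘ ^ 2 := by ring
      _ ≤ wilsonFinTorusPartition ρ β a b c 2 * l₀ ^ M := by linarith
  exact ⟨l₀, lₘ, hlₘ, mgg_le_of_pow_succ_succ_le hlₘ hl₀.le hchain, hvac, hdom, htr⟩

/-! ### §3 The energy of an `(e, m)` sector above the untwisted vacuum splits as `E_{e|m} + E_m` -/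

/-- `log (C/B) + log (A/C) = log (A/B)` for positive reals (plumbing). [folklore] -/
private theorem mgg_log_div_add_log_div {A B C : ℝ} (hA : 0 < A) (hB : 0 < B) (hC : 0 < C) :
    Real.log (C / B) + Real.log (A / C) = Real.log (A / B) := by
  rw [Real.log_div hC.ne' hB.ne', Real.log_div hA.ne' hC.ne', Real.log_div hA.ne' hB.ne']
  ring

/-- ★ **'t Hooft's `E(e, m; a) − E(0, 0; a)` is the sum of the electric flux energy in the magnetic sector and the magnetic
flux energy**: for the fluxes `e = (n₀χ, n₁χ, n₂χ)` generated by the character `χ` seen by `ρ` (given room: `n₀ ≤ bc`,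
`n₁ ≤ ac`, `n₂ ≤ ab`), every `m`, every box with positive sides and `β > 0`,
`(1/M) · log (Re e^{−F}(0|0)(M+2) / Re e^{−F}(e|m)(M+2)) → E_{e|m} + E_m`
(`wilsonFinTorusFluxTransformEnergy` + `wilsonFinTorusMagneticGroundEnergy`): the zero-temperature limit of the free energy of
the `(e, m)` sector, measured from the untwisted vacuum, exists. [cite: tHooft1979Flux, §5 after (5.4) and §8 (8.10)]
[cite: Greensite2011, §4.4 (4.41)–(4.44)] -/
theorem tendsto_log_wilsonFinTorusFluxTransform_vacuum_div_of_flux (hρ : Continuous ρ)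
    (hρu : ∀ g, ρ g ∈ Matrix.unitaryGroup (Fin N) ℂ) [NeZero N] {β : ℝ} (hβ : 0 < β) {φ : Γ → G} (hφ0 : φ 0 = 1)
    (hφadd : ∀ k k', φ (k + k') = φ k * φ k') (hφc : ∀ k, φ k ∈ Subgroup.center G) {χ : AddChar Γ ℂ}
    (hχ : ∀ k, ρ (φ k) = (χ k) • (1 : Matrix (Fin N) (Fin N) ℂ)) (m₁₂ m₀₂ m₀₁ : Γ)
    {a b c : ℕ} [NeZero a] [NeZero b] [NeZero c] {n₀ n₁ n₂ : ℕ} (hn₀ : n₀ ≤ b * c) (hn₁ : n₁ ≤ a * c)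
    (hn₂ : n₂ ≤ a * b) :
    Tendsto (fun M : ℕ => Real.log ((wilsonFinTorusFluxTransform ρ β φ 0 0 0 0 0 0 a b c (M + 2)).re /
        (wilsonFinTorusFluxTransform ρ β φ (n₀ • χ) (n₁ • χ) (n₂ • χ) m₁₂ m₀₂ m₀₁ a b c (M + 2)).re) / M) atTop
      (𝓝 (wilsonFinTorusFluxTransformEnergy ρ β φ (n₀ • χ) (n₁ • χ) (n₂ • χ) m₁₂ m₀₂ m₀₁ a b c +
        wilsonFinTorusMagneticGroundEnergy ρ β φ m₁₂ m₀₂ m₀₁ a b c)) := by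
  have h₁ := tendsto_wilsonFinTorusFluxTransformEnergy_of_flux ρ hρ hρu hβ hφ0 hφadd hφc hχ m₁₂ m₀₂ m₀₁ hn₀ hn₁ hn₂
  have h₂ := tendsto_wilsonFinTorusMagneticGroundEnergy ρ hρ hρu hβ.le hφ0 hφadd hφc m₁₂ m₀₂ m₀₁ a b c
  refine (h₁.add h₂).congr' ?_
  obtain ⟨h0, hadd, hc⟩ := mgg_tripleTwist_hom (Γ := Γ) hφ0 hφadd hφc
  have htriv : tripleFluxChar (0 : AddChar Γ ℂ) 0 0 = 0 := (tripleFluxChar_eq_zero_iff 0 0 0).2 ⟨rfl, rfl, rfl⟩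
  obtain ⟨l₀, hl₀, -, hvac₀, -⟩ := mgg_ground_spectral ρ hρ hρu hβ.le
    (fun μ ν => φ (twistIdx (0 : Γ) 0 0 0 0 0 μ ν)) h0 hadd hc a b c
  obtain ⟨lₘ, hlₘ, -, hvacₘ, -⟩ := mgg_ground_spectral ρ hρ hρu hβ.le
    (fun μ ν => φ (twistIdx (0 : Γ) 0 0 m₁₂ m₀₂ m₀₁ μ ν)) h0 hadd hc a b c
  filter_upwards with M
  have hA : 0 < (wilsonFinTorusFluxTransform ρ β φ 0 0 0 0 0 0 a b c (M + 2)).re := by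
    rw [wilsonFinTorusFluxTransform_eq_magneticFluxPartition ρ β hφ0, htriv]
    exact lt_of_lt_of_le (by positivity) (hvac₀ M)
  have hC : 0 < (wilsonFinTorusFluxTransform ρ β φ 0 0 0 m₁₂ m₀₂ m₀₁ a b c (M + 2)).re := by
    rw [wilsonFinTorusFluxTransform_eq_magneticFluxPartition ρ β hφ0, htriv]
    exact lt_of_lt_of_le (by positivity) (hvacₘ M)
  have hB := wilsonFinTorusFluxTransform_re_pos_of_flux ρ hρ hρu hβ hφ0 hφadd hφc hχ m₁₂ m₀₂ m₀₁ hn₀ hn₁ hn₂ M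
  rw [← mgg_log_div_add_log_div hA hB hC, add_div]

/-- ★ **`E(e, m; a) ≥ E(0, 0; a)`: every flux sector lies above the untwisted vacuum** — `0 ≤ E_{e|m} + E_m` for the fluxes
generated by the seen character (room as above), every `m`, boxes with `a, c ≥ 2`, `b ≥ 1`, `β > 0`.
[cite: tHooft1979Flux, §5 after (5.4)] [cite: ReedSimonIV1978, Thm XIII.43 and Thm XIII.44] -/
theorem wilsonFinTorusFluxTransformEnergy_add_magneticGroundEnergy_nonneg (hρ : Continuous ρ)
    (hρu : ∀ g, ρ g ∈ Matrix.unitaryGroup (Fin N) ℂ) [NeZero N] {β : ℝ} (hβ : 0 < β) {φ : Γ → G} (hφ0 : φ 0 = 1)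
    (hφadd : ∀ k k', φ (k + k') = φ k * φ k') (hφc : ∀ k, φ k ∈ Subgroup.center G) {χ : AddChar Γ ℂ}
    (hχ : ∀ k, ρ (φ k) = (χ k) • (1 : Matrix (Fin N) (Fin N) ℂ)) (m₁₂ m₀₂ m₀₁ : Γ)
    {a b c : ℕ} (ha : 2 ≤ a) [NeZero b] (hc2 : 2 ≤ c) {n₀ n₁ n₂ : ℕ} (hn₀ : n₀ ≤ b * c) (hn₁ : n₁ ≤ a * c)
    (hn₂ : n₂ ≤ a * b) :
    0 ≤ wilsonFinTorusFluxTransformEnergy ρ β φ (n₀ • χ) (n₁ • χ) (n₂ • χ) m₁₂ m₀₂ m₀₁ a b c +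
        wilsonFinTorusMagneticGroundEnergy ρ β φ m₁₂ m₀₂ m₀₁ a b c := by
  haveI : NeZero a := ⟨by omega⟩
  haveI : NeZero c := ⟨by omega⟩
  refine add_nonneg ?_ (wilsonFinTorusMagneticGroundEnergy_nonneg ρ hρ hρu hβ.le hφ0 hφadd hφc m₁₂ m₀₂ m₀₁ ha hc2)
  by_cases he : n₀ • χ = 0 ∧ n₁ • χ = 0 ∧ n₂ • χ = 0
  · obtain ⟨e₀, e₁, e₂⟩ := he
    rw [e₀, e₁, e₂, wilsonFinTorusFluxTransformEnergy_zero]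
  · exact (wilsonFinTorusFluxTransformEnergy_pos_of_flux ρ hρ hρu hβ hφ0 hφadd hφc hχ m₁₂ m₀₂ m₀₁ hn₀ hn₁ hn₂ he).le

/-- ★ **`E(e, m; a) > E(0, 0; a)` for every non-zero electric flux seen by `ρ`, in every magnetic sector**:
`0 < E_{e|m} + E_m` (`e ≠ 0`; room and box as above).  One box at fixed `β`; nothing about `a_i → ∞`.
[cite: tHooft1979Flux, §4 (4.10) and §5 after (5.4)] [cite: Hopf1963, Thm 4] -/
theorem wilsonFinTorusFluxTransformEnergy_add_magneticGroundEnergy_pos (hρ : Continuous ρ)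
    (hρu : ∀ g, ρ g ∈ Matrix.unitaryGroup (Fin N) ℂ) [NeZero N] {β : ℝ} (hβ : 0 < β) {φ : Γ → G} (hφ0 : φ 0 = 1)
    (hφadd : ∀ k k', φ (k + k') = φ k * φ k') (hφc : ∀ k, φ k ∈ Subgroup.center G) {χ : AddChar Γ ℂ}
    (hχ : ∀ k, ρ (φ k) = (χ k) • (1 : Matrix (Fin N) (Fin N) ℂ)) (m₁₂ m₀₂ m₀₁ : Γ)
    {a b c : ℕ} (ha : 2 ≤ a) [NeZero b] (hc2 : 2 ≤ c) {n₀ n₁ n₂ : ℕ} (hn₀ : n₀ ≤ b * c) (hn₁ : n₁ ≤ a * c)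
    (hn₂ : n₂ ≤ a * b) (he : ¬ (n₀ • χ = 0 ∧ n₁ • χ = 0 ∧ n₂ • χ = 0)) :
    0 < wilsonFinTorusFluxTransformEnergy ρ β φ (n₀ • χ) (n₁ • χ) (n₂ • χ) m₁₂ m₀₂ m₀₁ a b c +
        wilsonFinTorusMagneticGroundEnergy ρ β φ m₁₂ m₀₂ m₀₁ a b c := by
  haveI : NeZero a := ⟨by omega⟩
  haveI : NeZero c := ⟨by omega⟩
  exact add_pos_of_pos_of_nonneg
    (wilsonFinTorusFluxTransformEnergy_pos_of_flux ρ hρ hρu hβ hφ0 hφadd hφc hχ m₁₂ m₀₂ m₀₁ hn₀ hn₁ hn₂ he)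
    (wilsonFinTorusMagneticGroundEnergy_nonneg ρ hρ hρu hβ.le hφ0 hφadd hφc m₁₂ m₀₂ m₀₁ ha hc2)

end Spectral

end Literature.MathematicalPhysics.QuantumFieldTheory

end
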